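import Summits.Ventures.Crystal3D.Theorems.StickyWulffConstantNoReconstructionGainHollowLoad
import Summits.Ventures.Crystal3D.Theorems.StickyWulffConstantNoReconstructionGainConfinedCertificateHalf
import Literature.Geometry.DiscreteGeometry.KerteszAzimuthArcs
import Mathlib.Analysis.SpecialFunctions.Complex.Arg
import HarnessLib

/-!
# Cap counts: how many `60°`-code vectors fit above a given height in the cap zone `[t, √(2/3)]`
# (crux `NoReconstructionGain`, stmt-Ventures-19144, line `replication-exactness`, inside `stub_noCriminal`)

HONEST FRAMING. Part of the venture `Summits/Ventures/Crystal3D` (cell `crystal3d-full`), helper `--supports` the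
crux `NoReconstructionGain` (stmt-Ventures-19144, route `route-Ventures-StickyWulffConstant`), lead wulff-p1 g24.
Spherical-code BUILDING BLOCKS (threshold lemmas) for the slack rows of the `W = √(2/3)` windowed certificate
(cell memo HOLLOW-g24 §2b: the plug-free band needs upper bounds on height sums such as «8 partners below a top
ball have `Σ|u₂| ≤ 4c`»); nothing about films; the crux is not moved.

`c = √(2/3)`.  For a `60°`-code `F` (unit vectors, pairwise inner products `≤ 1/2`) and a threshold `t`, write
`F[t] := {u ∈ F : t ≤ u₂ ≤ c}`.  By the spherical law of cosines two such vectors differ in azimuth by an angle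
with `cos ≤ (1/2 − u₂v₂)/(ρ_u ρ_v) ≤ κ(t) := max(R(t,t), R(c,t))`, `R(z,z') = (1/2 − zz')/√((1−z²)(1−z'²))`; the
budget of this lead (`azimuth_weighted_budget`, p752841) with constant weights then gives
`|F[t]| · arccos κ(t) ≤ 2π`:

* `card_le_of_arcs_ge` — the constant-weight budget: if all pairs of a finite family of vectors with
  non-zero horizontal parts have azimuth-difference cosine `≤ κ` and `(m+1)·arccos κ > 2π`, the family has
  at most `m` members;
* `arcs_ge_arccos_of_pair`, `card_cap_le_of_pairBound` — the law-of-cosines step and the count from a pair bound;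
* the table (all in the cap zone `u₂ ≤ c`; thresholds chosen with rational margins):
  `card_cap_ge_071_le_three` (`t = 0.71`: at most `3`), `card_cap_ge_054_le_four` (`t = 0.54`: at most `4`;
  `cos (2π/5) = (√5−1)/4 > 3/10`), `card_cap_ge_029_le_five` (`t = 0.29`: at most `5`),
  `card_cap_ge_020_le_six` (`t = 0.2`: at most `6`; `cos (2π/7) ≥ 61/100`), `card_cap_ge_014_le_seven`
  (`t = 0.14`: at most `7`).  Known neighbours: `> 0` ⇒ `≤ 8` (Kertész, `card_le_eight_of_openHemisphere'`),
  `≥ 0` ⇒ `≤ 9` (`B(3) = 9`), `= c` ⇒ `≤ 3` (`card_mul_sq_le_of_sameHeight`).  Numerically the true thresholds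
  are ≈ `0.7071 / 0.526 / 0.27 / 0.18 / 0.12`.

WHAT THIS IS NOT: no height-SUM bound is proved here (layer-cake with these thresholds gives `Σ u₂ ≤ 4.12` for
seven cap-zone vectors, just above the `5c = 4.08` the seven-partner top row needs — the joint constraints are the
successor's work); rung F-C1 not moved.
-/

noncomputable section

namespace Summit.Ventures.Crystal3D.Theorems

open Finset Real
open scoped InnerProductSpace

/-! ## 1. Constant-weight budget -/

/-- **At most `m` azimuths pairwise at least `arccos κ` apart when `(m+1)·arccos κ > 2π`.**  For a finite family
`S` (indexed in `E³`, azimuth `t u`), if every pair `u ≠ v` with `t u ≤ t v` has both arcs `≥ θ₀` and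
`(m + 1) θ₀ > 2π` with `0 ≤ θ₀ ≤ π`, then `|S| ≤ m`. -/
theorem card_le_of_arcs_ge {ι : Type*} [DecidableEq ι] (S : Finset ι) (t : ι → ℝ) {θ₀ : ℝ} {m : ℕ}
    (h0 : 0 ≤ θ₀) (hπ : θ₀ ≤ π) (hm : 2 * π < (m + 1) * θ₀)
    (hgap : ∀ a ∈ S, ∀ b ∈ S, a ≠ b → t a ≤ t b → θ₀ ≤ t b - t a ∧ θ₀ ≤ 2 * π - (t b - t a)) :
    S.card ≤ m := by
  have hsum := azimuth_weighted_budget t (fun _ => θ₀ / 2) S (fun _ _ => by linarith)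
    (fun a ha b hb hab htab => by
      have h := hgap a ha b hb hab htab
      constructor <;> linarith [h.1, h.2])
  rw [sum_const, nsmul_eq_mul] at hsum
  by_contra hlt
  push Not at hlt
  have hm1 : (m : ℝ) + 1 ≤ S.card := by exact_mod_cast hlt
  nlinarith [hsum, hm1, h0, hm]

/-! ## 2. The law-of-cosines step for a pair in the cap zone -/

/-- `⟪x, y⟫ = x₀y₀ + x₁y₁ + x₂y₂` in `ℝ³` (local copy). -/
private theorem inner_three_cc (x y : EuclideanSpace ℝ (Fin 3)) :
    ⟪x, y⟫_ℝ = x 0 * y 0 + x 1 * y 1 + x 2 * y 2 := by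
  simp [PiLp.inner_apply, Fin.sum_univ_three, mul_comm]

/-- The horizontal part of a unit vector of height `z` has norm `√(1 − z²)` (local copy). -/
private theorem norm_horiz_cc {u : EuclideanSpace ℝ (Fin 3)} (hu : ‖u‖ = 1) :
    ‖(⟨u 0, u 1⟩ : ℂ)‖ = Real.sqrt (1 - u 2 ^ 2) := by
  have h2 : ‖(⟨u 0, u 1⟩ : ℂ)‖ ^ 2 = 1 - u 2 ^ 2 := by
    rw [Complex.sq_norm, Complex.normSq_mk]
    have h := real_inner_self_eq_norm_sq u
    rw [inner_three_cc, hu, one_pow] at h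
    nlinarith [h]
  rw [← h2, Real.sqrt_sq (norm_nonneg _)]

/-- **Both arcs from a cosine bound.**  If two unit vectors `u ≠ v` with `⟪u, v⟫ ≤ 1/2`, both of height `≤ c < 1`
in absolute value... precisely with `u₂², v₂² < 1`, satisfy `1/2 − u₂ v₂ ≤ κ · √(1−u₂²) · √(1−v₂²)` for some
`κ ∈ [−1, 1]`, and their azimuths are ordered `θ_u ≤ θ_v`, then both arcs between the azimuths are `≥ arccos κ`. -/
theorem arcs_ge_arccos_of_pair {u v : EuclideanSpace ℝ (Fin 3)} (hu : ‖u‖ = 1) (hv : ‖v‖ = 1)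
    (huv : ⟪u, v⟫_ℝ ≤ 1 / 2) (hu2 : u 2 ^ 2 < 1) (hv2 : v 2 ^ 2 < 1) {κ : ℝ}
    (hκ : 1 / 2 - u 2 * v 2 ≤ κ * (Real.sqrt (1 - u 2 ^ 2) * Real.sqrt (1 - v 2 ^ 2)))
    (hθ : Complex.arg ⟨u 0, u 1⟩ ≤ Complex.arg ⟨v 0, v 1⟩) :
    Real.arccos κ ≤ Complex.arg ⟨v 0, v 1⟩ - Complex.arg ⟨u 0, u 1⟩ ∧
      Real.arccos κ ≤ 2 * π - (Complex.arg ⟨v 0, v 1⟩ - Complex.arg ⟨u 0, u 1⟩) := by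
  set zu : ℂ := ⟨u 0, u 1⟩ with hzu
  set zv : ℂ := ⟨v 0, v 1⟩ with hzv
  have hnu : ‖zu‖ = Real.sqrt (1 - u 2 ^ 2) := by rw [hzu, norm_horiz_cc hu]
  have hnv : ‖zv‖ = Real.sqrt (1 - v 2 ^ 2) := by rw [hzv, norm_horiz_cc hv]
  have hnu0 : 0 < ‖zu‖ := by rw [hnu]; exact Real.sqrt_pos.2 (by linarith)
  have hnv0 : 0 < ‖zv‖ := by rw [hnv]; exact Real.sqrt_pos.2 (by linarith)
  have hzu0 : zu ≠ 0 := norm_pos_iff.1 hnu0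
  have hzv0 : zv ≠ 0 := norm_pos_iff.1 hnv0
  have hin : ⟪u, v⟫_ℝ = ‖zu‖ * ‖zv‖ * Real.cos (Complex.arg zu - Complex.arg zv) + u 2 * v 2 := by
    rw [inner_three_cc, ← re_mul_add_im_mul zu zv hzu0 hzv0]
  rw [← hnu, ← hnv] at hκ
  have h1 : ‖zu‖ * ‖zv‖ * Real.cos (Complex.arg zu - Complex.arg zv) ≤ ‖zu‖ * ‖zv‖ * κ := by
    linarith [hin, huv, hκ]
  have hcosle : Real.cos (Complex.arg zv - Complex.arg zu) ≤ κ := by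
    rw [← Real.cos_neg, neg_sub]
    exact le_of_mul_le_mul_left h1 (mul_pos hnu0 hnv0)
  have hx0 : 0 ≤ Complex.arg zv - Complex.arg zu := by linarith
  have hx1 : Complex.arg zv - Complex.arg zu ≤ 2 * π := by
    linarith [Complex.arg_le_pi zv, Complex.neg_pi_lt_arg zu]
  exact Literature.Geometry.DiscreteGeometry.arccos_le_and_le_of_cos_le hx0 hx1 hcosle

/-- **Cap count from a pair bound.**  If every pair of members of the cap-zone part `F[t] = {t ≤ u₂ ≤ √(2/3)}`
of a `60°`-code satisfies `1/2 − u₂v₂ ≤ κ √(1−u₂²) √(1−v₂²)`, and `(m+1)·arccos κ > 2π`, then `|F[t]| ≤ m`. -/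
theorem card_cap_le_of_pairBound (F : Finset (EuclideanSpace ℝ (Fin 3))) (h1 : ∀ u ∈ F, ‖u‖ = 1)
    (h2 : ∀ u ∈ F, ∀ v ∈ F, u ≠ v → ⟪u, v⟫_ℝ ≤ 1 / 2) (t κ : ℝ) (m : ℕ)
    (hm : 2 * π < (m + 1) * Real.arccos κ)
    (hpair : ∀ z z' : ℝ, t ≤ z → z ≤ Real.sqrt (2 / 3) → t ≤ z' → z' ≤ Real.sqrt (2 / 3) →
      1 / 2 - z * z' ≤ κ * (Real.sqrt (1 - z ^ 2) * Real.sqrt (1 - z' ^ 2))) (ht : -1 < t) :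
    (F.filter fun u => t ≤ u 2 ∧ u 2 ≤ Real.sqrt (2 / 3)).card ≤ m := by
  classical
  have hc2 : Real.sqrt (2 / 3) ^ 2 = 2 / 3 := Real.sq_sqrt (by norm_num)
  have hcpos : 0 < Real.sqrt (2 / 3) := Real.sqrt_pos.2 (by norm_num)
  set S := F.filter (fun u => t ≤ u 2 ∧ u 2 ≤ Real.sqrt (2 / 3)) with hS
  have hSmem : ∀ u, u ∈ S ↔ u ∈ F ∧ t ≤ u 2 ∧ u 2 ≤ Real.sqrt (2 / 3) := fun u => by rw [hS, mem_filter]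
  have hc1 : Real.sqrt (2 / 3) < 1 := by nlinarith
  have hsq : ∀ u ∈ S, u 2 ^ 2 < 1 := by
    intro u hu
    have h := (hSmem u).1 hu
    have hlo : -1 < u 2 := lt_of_lt_of_le ht h.2.1
    have hhi : u 2 < 1 := lt_of_le_of_lt h.2.2 hc1
    nlinarith [mul_pos (sub_pos.2 hhi) (by linarith : (0:ℝ) < 1 + u 2)]
  refine card_le_of_arcs_ge S (fun u => Complex.arg ⟨u 0, u 1⟩) (Real.arccos_nonneg κ) (Real.arccos_le_pi κ)
    hm fun a ha b hb hab htab => ?_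
  have ha' := (hSmem a).1 ha
  have hb' := (hSmem b).1 hb
  exact arcs_ge_arccos_of_pair (h1 a ha'.1) (h1 b hb'.1) (h2 a ha'.1 b hb'.1 hab) (hsq a ha) (hsq b hb)
    (hpair (a 2) (b 2) ha'.2.1 ha'.2.2 hb'.2.1 hb'.2.2) htab

/-! ## 3. The table -/

/-- A concave quadratic that is non-negative at the ends of an interval is non-negative on it. -/
private theorem quad_nonneg_Icc {A B C t s x : ℝ} (hC : 0 ≤ C) (htx : t ≤ x) (hxs : x ≤ s)
    (ht : 0 ≤ A + B * t - C * t ^ 2) (hs : 0 ≤ A + B * s - C * s ^ 2) : 0 ≤ A + B * x - C * x ^ 2 := by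
  have key : (s - t) * (A + B * x - C * x ^ 2) =
      (s - x) * (A + B * t - C * t ^ 2) + (x - t) * (A + B * s - C * s ^ 2) + C * ((x - t) * (s - x)) * (s - t) := by
    ring
  rcases eq_or_lt_of_le (htx.trans hxs) with hts | hts
  · have hxt : x = t := le_antisymm (hts ▸ hxs) htx
    rw [hxt]; exact ht
  · have hprod : 0 ≤ (s - x) * (A + B * t - C * t ^ 2) + (x - t) * (A + B * s - C * s ^ 2) +
        C * ((x - t) * (s - x)) * (s - t) := by
      have h1 := mul_nonneg (sub_nonneg.2 hxs) ht
      have h2 := mul_nonneg (sub_nonneg.2 htx) hs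
      have h3 := mul_nonneg (mul_nonneg hC (mul_nonneg (sub_nonneg.2 htx) (sub_nonneg.2 hxs))) (sub_pos.2 hts).le
      linarith
    rw [← key] at hprod
    by_contra hneg
    push Not at hneg
    exact absurd hprod (not_le.2 (mul_neg_of_pos_of_neg (sub_pos.2 hts) hneg))

/-- Squaring step: if `L ≤ 0` or `L² ≤ κ² (1−z²)(1−z'²)` with `κ ≥ 0`, then `L ≤ κ √(1−z²) √(1−z'²)`. -/
private theorem le_mul_sqrt_of_sq {L κ z z' : ℝ} (hκ : 0 ≤ κ) (hz : z ^ 2 ≤ 1) (hz' : z' ^ 2 ≤ 1)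
    (h : L ≤ 0 ∨ L ^ 2 ≤ κ ^ 2 * ((1 - z ^ 2) * (1 - z' ^ 2))) :
    L ≤ κ * (Real.sqrt (1 - z ^ 2) * Real.sqrt (1 - z' ^ 2)) := by
  have hX : 0 ≤ 1 - z ^ 2 := by linarith
  have hY : 0 ≤ 1 - z' ^ 2 := by linarith
  have hR : 0 ≤ κ * (Real.sqrt (1 - z ^ 2) * Real.sqrt (1 - z' ^ 2)) := by positivity
  rcases h with h | h
  · exact h.trans hR
  · by_cases hL : L ≤ 0
    · exact hL.trans hR
    · push Not at hL
      rw [← pow_le_pow_iff_left₀ hL.le hR two_ne_zero]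
      calc L ^ 2 ≤ κ ^ 2 * ((1 - z ^ 2) * (1 - z' ^ 2)) := h
        _ = (κ * (Real.sqrt (1 - z ^ 2) * Real.sqrt (1 - z' ^ 2))) ^ 2 := by
          rw [mul_pow, mul_pow, Real.sq_sqrt hX, Real.sq_sqrt hY]

/-- **Corner test for the squared pair bound.**  With `G(z,z') := κ²(1−z²)(1−z'²) − (1/2 − zz')²` (a concave
quadratic in each variable separately), non-negativity of `G` at the four corners `(t,t), (s,t), (t,c), (s,c)`,
`s = 71/100`, `c = √(2/3)`, gives for all `z, z' ∈ [t, c]`: `1/2 − zz' ≤ 0` or `(1/2 − zz')² ≤ κ²(1−z²)(1−z'²)`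
(on `[s, c]²` the product `zz'` exceeds `1/2`). -/
private theorem pair_sq_bound_of_corners {t κ : ℝ} (ht0 : 0 ≤ t)
    (h_tt : 0 ≤ κ ^ 2 * ((1 - t ^ 2) * (1 - t ^ 2)) - (1 / 2 - t * t) ^ 2)
    (h_st : 0 ≤ κ ^ 2 * ((1 - (71 / 100) ^ 2) * (1 - t ^ 2)) - (1 / 2 - 71 / 100 * t) ^ 2)
    (h_tc : 0 ≤ κ ^ 2 * ((1 - t ^ 2) * (1 - Real.sqrt (2 / 3) ^ 2)) - (1 / 2 - t * Real.sqrt (2 / 3)) ^ 2)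
    (h_sc : 0 ≤ κ ^ 2 * ((1 - (71 / 100) ^ 2) * (1 - Real.sqrt (2 / 3) ^ 2)) -
      (1 / 2 - 71 / 100 * Real.sqrt (2 / 3)) ^ 2)
    {z z' : ℝ} (hz : t ≤ z) (hzc : z ≤ Real.sqrt (2 / 3)) (hz' : t ≤ z') (hz'c : z' ≤ Real.sqrt (2 / 3)) :
    1 / 2 - z * z' ≤ 0 ∨ (1 / 2 - z * z') ^ 2 ≤ κ ^ 2 * ((1 - z ^ 2) * (1 - z' ^ 2)) := by
  set c : ℝ := Real.sqrt (2 / 3) with hc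
  have hc2 : c ^ 2 = 2 / 3 := Real.sq_sqrt (by norm_num)
  have hcpos : 0 < c := Real.sqrt_pos.2 (by norm_num)
  have hsc : (71 / 100 : ℝ) ≤ c := by nlinarith
  set s : ℝ := 71 / 100 with hs
  -- `G(x, y)` as a concave quadratic in `y`: `A x + x·y − C x · y²`
  have hG : ∀ x y : ℝ, κ ^ 2 * ((1 - x ^ 2) * (1 - y ^ 2)) - (1 / 2 - x * y) ^ 2 =
      (κ ^ 2 * (1 - x ^ 2) - 1 / 4) + x * y - (κ ^ 2 * (1 - x ^ 2) + x ^ 2) * y ^ 2 := by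
    intro x y; ring
  have hCx : ∀ x : ℝ, 0 ≤ x → x ≤ c → 0 ≤ κ ^ 2 * (1 - x ^ 2) + x ^ 2 := by
    intro x hx0 hx
    have : x ^ 2 ≤ 1 := by nlinarith [hc2]
    nlinarith [sq_nonneg κ, sq_nonneg x, mul_nonneg (sq_nonneg κ) (sub_nonneg.2 this)]
  -- one-variable step: `G(x, t) ≥ 0` and `G(x, c) ≥ 0` for `x ∈ [t, s]`
  have hGxt : ∀ x, t ≤ x → x ≤ s → 0 ≤ κ ^ 2 * ((1 - x ^ 2) * (1 - t ^ 2)) - (1 / 2 - x * t) ^ 2 := by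
    intro x hx hxs
    have e : ∀ x : ℝ, κ ^ 2 * ((1 - x ^ 2) * (1 - t ^ 2)) - (1 / 2 - x * t) ^ 2 =
        (κ ^ 2 * (1 - t ^ 2) - 1 / 4) + t * x - (κ ^ 2 * (1 - t ^ 2) + t ^ 2) * x ^ 2 := by intro x; ring
    rw [e]
    refine quad_nonneg_Icc (hCx t ht0 (by linarith)) hx hxs ?_ ?_
    · rw [← e]; exact h_tt
    · rw [← e]; exact h_st
  have hGxc : ∀ x, t ≤ x → x ≤ s → 0 ≤ κ ^ 2 * ((1 - x ^ 2) * (1 - c ^ 2)) - (1 / 2 - x * c) ^ 2 := by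
    intro x hx hxs
    have e : ∀ x : ℝ, κ ^ 2 * ((1 - x ^ 2) * (1 - c ^ 2)) - (1 / 2 - x * c) ^ 2 =
        (κ ^ 2 * (1 - c ^ 2) - 1 / 4) + c * x - (κ ^ 2 * (1 - c ^ 2) + c ^ 2) * x ^ 2 := by intro x; ring
    rw [e]
    refine quad_nonneg_Icc (hCx c hcpos.le le_rfl) hx hxs ?_ ?_
    · rw [← e]; exact h_tc
    · rw [← e]; exact h_sc
  -- two-variable step
  have hbox : ∀ x y, t ≤ x → x ≤ s → t ≤ y → y ≤ c →
      0 ≤ κ ^ 2 * ((1 - x ^ 2) * (1 - y ^ 2)) - (1 / 2 - x * y) ^ 2 := by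
    intro x y hx hxs hy hyc
    rw [hG]
    refine quad_nonneg_Icc (hCx x (by linarith) (by linarith)) hy hyc ?_ ?_
    · rw [← hG]; exact hGxt x hx hxs
    · rw [← hG]; exact hGxc x hx hxs
  by_cases h1 : z ≤ s
  · right; linarith [hbox z z' hz h1 hz' hz'c]
  by_cases h2 : z' ≤ s
  · right
    have := hbox z' z hz' h2 hz hzc
    have e : κ ^ 2 * ((1 - z' ^ 2) * (1 - z ^ 2)) - (1 / 2 - z' * z) ^ 2 =
        κ ^ 2 * ((1 - z ^ 2) * (1 - z' ^ 2)) - (1 / 2 - z * z') ^ 2 := by ring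
    linarith [e]
  · left
    push Not at h1 h2
    rw [hs] at h1 h2
    nlinarith

/-- `0.8164 < √(2/3) < 0.8166`. -/
private theorem sqrt_two_thirds_bounds_cc : (8164 / 10000 : ℝ) < Real.sqrt (2 / 3) ∧ Real.sqrt (2 / 3) < 8166 / 10000 := by
  constructor
  · rw [show (8164 / 10000 : ℝ) = Real.sqrt ((8164 / 10000) ^ 2) by rw [Real.sqrt_sq (by norm_num)]]
    exact Real.sqrt_lt_sqrt (by norm_num) (by norm_num)
  · rw [show (8166 / 10000 : ℝ) = Real.sqrt ((8166 / 10000) ^ 2) by rw [Real.sqrt_sq (by norm_num)]]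
    exact Real.sqrt_lt_sqrt (by norm_num) (by norm_num)

/-- **At most three code vectors with `0.71 ≤ u₂ ≤ √(2/3)`** (`u₂u₂' > 1/2` forces an azimuth gap `> 90°`). -/
theorem card_cap_ge_071_le_three (F : Finset (EuclideanSpace ℝ (Fin 3))) (h1 : ∀ u ∈ F, ‖u‖ = 1)
    (h2 : ∀ u ∈ F, ∀ v ∈ F, u ≠ v → ⟪u, v⟫_ℝ ≤ 1 / 2) :
    (F.filter fun u => (71 / 100 : ℝ) ≤ u 2 ∧ u 2 ≤ Real.sqrt (2 / 3)).card ≤ 3 := by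
  have hc2 : Real.sqrt (2 / 3) ^ 2 = 2 / 3 := Real.sq_sqrt (by norm_num)
  have hκ : 2 * π < ((3 : ℕ) + 1 : ℝ) * Real.arccos (-(1 / 250)) := by
    have h : π / 2 < Real.arccos (-(1 / 250)) := by
      rw [Real.arccos_neg]
      have := (Real.arccos_lt_pi_div_two (x := (1 / 250 : ℝ))).2 (by norm_num)
      linarith
    push_cast; linarith
  refine card_cap_le_of_pairBound F h1 h2 _ _ 3 hκ (fun z z' hz hzc hz' hz'c => ?_) (by norm_num)
  have hX : 0 ≤ 1 - z ^ 2 := by nlinarith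
  have hY : 0 ≤ 1 - z' ^ 2 := by nlinarith
  have hρ : Real.sqrt (1 - z ^ 2) * Real.sqrt (1 - z' ^ 2) ≤ 1 := by
    rw [← Real.sqrt_mul hX]
    calc Real.sqrt ((1 - z ^ 2) * (1 - z' ^ 2)) ≤ Real.sqrt 1 := Real.sqrt_le_sqrt (by nlinarith)
      _ = 1 := Real.sqrt_one
  nlinarith [mul_nonneg (Real.sqrt_nonneg (1 - z ^ 2)) (Real.sqrt_nonneg (1 - z' ^ 2))]

/-- `cos (2π/5) = (√5 − 1)/4 > 3/10`. -/
private theorem three_tenths_lt_cos_two_pi_div_five : (3 / 10 : ℝ) < Real.cos (2 * π / 5) := by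
  have h : Real.cos (2 * π / 5) = 2 * Real.cos (π / 5) ^ 2 - 1 := by
    rw [show 2 * π / 5 = 2 * (π / 5) by ring, Real.cos_two_mul]
  rw [h, Real.cos_pi_div_five]
  have h5 : Real.sqrt 5 ^ 2 = 5 := Real.sq_sqrt (by norm_num)
  have h5' : (22 / 10 : ℝ) < Real.sqrt 5 := by
    rw [show (22 / 10 : ℝ) = Real.sqrt ((22 / 10) ^ 2) by rw [Real.sqrt_sq (by norm_num)]]
    exact Real.sqrt_lt_sqrt (by norm_num) (by norm_num)
  nlinarith [h5, h5']

/-- The generic table entry: corner test ⇒ pair bound ⇒ count. -/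
private theorem card_cap_le_of_corners (F : Finset (EuclideanSpace ℝ (Fin 3))) (h1 : ∀ u ∈ F, ‖u‖ = 1)
    (h2 : ∀ u ∈ F, ∀ v ∈ F, u ≠ v → ⟪u, v⟫_ℝ ≤ 1 / 2) {t κ : ℝ} {m : ℕ} (ht0 : 0 ≤ t)
    (hκ : 0 ≤ κ) (hm : 2 * π < (m + 1) * Real.arccos κ)
    (h_tt : 0 ≤ κ ^ 2 * ((1 - t ^ 2) * (1 - t ^ 2)) - (1 / 2 - t * t) ^ 2)
    (h_st : 0 ≤ κ ^ 2 * ((1 - (71 / 100) ^ 2) * (1 - t ^ 2)) - (1 / 2 - 71 / 100 * t) ^ 2)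
    (h_tc : 0 ≤ κ ^ 2 * ((1 - t ^ 2) * (1 - Real.sqrt (2 / 3) ^ 2)) - (1 / 2 - t * Real.sqrt (2 / 3)) ^ 2)
    (h_sc : 0 ≤ κ ^ 2 * ((1 - (71 / 100) ^ 2) * (1 - Real.sqrt (2 / 3) ^ 2)) -
      (1 / 2 - 71 / 100 * Real.sqrt (2 / 3)) ^ 2) :
    (F.filter fun u => t ≤ u 2 ∧ u 2 ≤ Real.sqrt (2 / 3)).card ≤ m := by
  have hc2 : Real.sqrt (2 / 3) ^ 2 = 2 / 3 := Real.sq_sqrt (by norm_num)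
  refine card_cap_le_of_pairBound F h1 h2 t κ m hm (fun z z' hz hzc hz' hz'c => ?_) (by linarith)
  exact le_mul_sqrt_of_sq hκ (by nlinarith) (by nlinarith)
    (pair_sq_bound_of_corners ht0 h_tt h_st h_tc h_sc hz hzc hz' hz'c)

/-- **At most four code vectors with `0.54 ≤ u₂ ≤ √(2/3)`** (azimuth gaps `> 72°`). -/
theorem card_cap_ge_054_le_four (F : Finset (EuclideanSpace ℝ (Fin 3))) (h1 : ∀ u ∈ F, ‖u‖ = 1)
    (h2 : ∀ u ∈ F, ∀ v ∈ F, u ≠ v → ⟪u, v⟫_ℝ ≤ 1 / 2) :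
    (F.filter fun u => (54 / 100 : ℝ) ≤ u 2 ∧ u 2 ≤ Real.sqrt (2 / 3)).card ≤ 4 := by
  have hc2 : Real.sqrt (2 / 3) ^ 2 = 2 / 3 := Real.sq_sqrt (by norm_num)
  obtain ⟨hcl, hcu⟩ := sqrt_two_thirds_bounds_cc
  have hκ : 2 * π < ((4 : ℕ) + 1 : ℝ) * Real.arccos (3 / 10) := by
    have h : 2 * π / 5 < Real.arccos (3 / 10) := by
      have h0 : 0 ≤ 2 * π / 5 := by positivity
      have hπ' : 2 * π / 5 ≤ π := by linarith [pi_pos]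
      rw [← Real.arccos_cos h0 hπ']
      exact Real.strictAntiOn_arccos ⟨by norm_num, by norm_num⟩
        ⟨by linarith [Real.neg_one_le_cos (2 * π / 5)], Real.cos_le_one _⟩ three_tenths_lt_cos_two_pi_div_five
    push_cast; linarith
  refine card_cap_le_of_corners F h1 h2 (by norm_num) (by norm_num) hκ ?_ ?_ ?_ ?_
  · norm_num
  · norm_num
  · rw [hc2]; nlinarith
  · rw [hc2]; nlinarith

/-- **At most five code vectors with `0.29 ≤ u₂ ≤ √(2/3)`** (azimuth gaps `> 60°`). -/
theorem card_cap_ge_029_le_five (F : Finset (EuclideanSpace ℝ (Fin 3))) (h1 : ∀ u ∈ F, ‖u‖ = 1)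
    (h2 : ∀ u ∈ F, ∀ v ∈ F, u ≠ v → ⟪u, v⟫_ℝ ≤ 1 / 2) :
    (F.filter fun u => (29 / 100 : ℝ) ≤ u 2 ∧ u 2 ≤ Real.sqrt (2 / 3)).card ≤ 5 := by
  have hc2 : Real.sqrt (2 / 3) ^ 2 = 2 / 3 := Real.sq_sqrt (by norm_num)
  obtain ⟨hcl, hcu⟩ := sqrt_two_thirds_bounds_cc
  have hκ : 2 * π < ((5 : ℕ) + 1 : ℝ) * Real.arccos (12 / 25) := by
    have h : π / 3 < Real.arccos (12 / 25) := by
      have h0 : 0 ≤ π / 3 := by positivity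
      have hπ' : π / 3 ≤ π := by linarith [pi_pos]
      rw [← Real.arccos_cos h0 hπ', Real.cos_pi_div_three]
      exact Real.strictAntiOn_arccos ⟨by norm_num, by norm_num⟩ ⟨by norm_num, by norm_num⟩ (by norm_num)
    push_cast; linarith
  refine card_cap_le_of_corners F h1 h2 (by norm_num) (by norm_num) hκ ?_ ?_ ?_ ?_
  · norm_num
  · norm_num
  · rw [hc2]; nlinarith
  · rw [hc2]; nlinarith

/-- **At most six code vectors with `0.2 ≤ u₂ ≤ √(2/3)`** (azimuth gaps `> 2π/7`; `cos (2π/7) ≥ 61/100`). -/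
theorem card_cap_ge_020_le_six (F : Finset (EuclideanSpace ℝ (Fin 3))) (h1 : ∀ u ∈ F, ‖u‖ = 1)
    (h2 : ∀ u ∈ F, ∀ v ∈ F, u ≠ v → ⟪u, v⟫_ℝ ≤ 1 / 2) :
    (F.filter fun u => (1 / 5 : ℝ) ≤ u 2 ∧ u 2 ≤ Real.sqrt (2 / 3)).card ≤ 6 := by
  have hc2 : Real.sqrt (2 / 3) ^ 2 = 2 / 3 := Real.sq_sqrt (by norm_num)
  obtain ⟨hcl, hcu⟩ := sqrt_two_thirds_bounds_cc
  have hκ : 2 * π < ((6 : ℕ) + 1 : ℝ) * Real.arccos (3 / 5) := by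
    have h : 2 * π / 7 < Real.arccos (3 / 5) := by
      have h0 : 0 ≤ 2 * π / 7 := by positivity
      have hπ' : 2 * π / 7 ≤ π := by linarith [pi_pos]
      rw [← Real.arccos_cos h0 hπ']
      refine Real.strictAntiOn_arccos ⟨by norm_num, by norm_num⟩
        ⟨by linarith [Real.neg_one_le_cos (2 * π / 7)], Real.cos_le_one _⟩ ?_
      linarith [cos_two_pi_div_seven_ge']
    push_cast; linarith
  refine card_cap_le_of_corners F h1 h2 (by norm_num) (by norm_num) hκ ?_ ?_ ?_ ?_
  · norm_num
  · norm_num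
  · rw [hc2]; nlinarith
  · rw [hc2]; nlinarith

/-- **At most seven code vectors with `0.14 ≤ u₂ ≤ √(2/3)`** (azimuth gaps `> 45°`). -/
theorem card_cap_ge_014_le_seven (F : Finset (EuclideanSpace ℝ (Fin 3))) (h1 : ∀ u ∈ F, ‖u‖ = 1)
    (h2 : ∀ u ∈ F, ∀ v ∈ F, u ≠ v → ⟪u, v⟫_ℝ ≤ 1 / 2) :
    (F.filter fun u => (7 / 50 : ℝ) ≤ u 2 ∧ u 2 ≤ Real.sqrt (2 / 3)).card ≤ 7 := by
  have hc2 : Real.sqrt (2 / 3) ^ 2 = 2 / 3 := Real.sq_sqrt (by norm_num)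
  obtain ⟨hcl, hcu⟩ := sqrt_two_thirds_bounds_cc
  have hκ : 2 * π < ((7 : ℕ) + 1 : ℝ) * Real.arccos (69 / 100) := by
    have h : π / 4 < Real.arccos (69 / 100) := by
      have h0 : 0 ≤ π / 4 := by positivity
      have hπ' : π / 4 ≤ π := by linarith [pi_pos]
      have h22 : Real.sqrt 2 ^ 2 = 2 := Real.sq_sqrt (by norm_num)
      have h2n := Real.sqrt_nonneg 2
      rw [← Real.arccos_cos h0 hπ', Real.cos_pi_div_four]
      refine Real.strictAntiOn_arccos ⟨by norm_num, by norm_num⟩ ⟨by nlinarith, by nlinarith⟩ (by nlinarith)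
    push_cast; linarith
  refine card_cap_le_of_corners F h1 h2 (by norm_num) (by norm_num) hκ ?_ ?_ ?_ ?_
  · norm_num
  · norm_num
  · rw [hc2]; nlinarith
  · rw [hc2]; nlinarith

end Summit.Ventures.Crystal3D.Theorems

end
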